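import Mathlib
import Literature.Computability.AlgebraicComplexity.GroupTheoreticMatMul

/-!
# At order 648 the single-member room constraints of `(7,7,7)⁵` are satisfiable: a ceiling for one-member rules (cell mm-stpp, eng-2 g5)

Every rule of the cell's energy family (E3 `STPPThreeRoomEnergy.three_room_energy`, E3⁺, E3⁺⁺, `energy_rooms`) and every candidate
«three-room law» constrains ONE member `t` of an STPP family through its three U14⁺ rooms
`R_A = |(A_t − A_t) + (B_t − C_t)|`, `R_B = |(B_t − B_t) + (C_t − A_t)|`, `R_C = |(C_t − C_t) + (A_t − B_t)|` against the caps
`R_X ≤ |G| − Σ_{u ≠ t}(pair products of the other members)` (`STPPPackingSumset.sum_card_mul_add_card_sumset_le` and rotations).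
For the uniform list `(7,7,7)⁵` — vQ-alive on its whole beating window `618–648` (`AbelianSTPPCensusVQWitnesses`, planner scratch VQTE618) —
the three caps at order `648` are `648 − 4·49 = 452`.

This file shows that at `|G| = 648` those single-member constraints CANNOT rule the list out: in the abelian group
`ℤ/8 × ℤ/9 × ℤ/9` the coordinate blocks `A = (ℤ/8 ∖ {7}) × 0 × 0`, `B = 0 × (ℤ/9 ∖ {7,8}) × 0`, `C = 0 × 0 × (ℤ/9 ∖ {7,8})` (sizes `7,7,7`,
volume `343 > 648/2`) form a TPP triple (`isSTPP_single_of_axes`: any three blocks on the three coordinate axes do) whose rooms are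
`(392, 441, 441)` — all `≤ 452` (`rooms_777_648`; kernel evaluation of the three sumset cardinalities).  So a member of a hypothetical
`(7,7,7)⁵` family at order 648 can have EXACTLY the room profile of this triple; no inequality in `(R_A, R_B, R_C, caps)` alone excludes it.
Any exclusion of `(7,7,7)⁵` at 648 must use the JOINT structure of two members (the STPP cross clauses), cf. HOME/STATUS eng-2 g5 FINDING (C).
Note `R_A + R_B + R_C = 1274 < 2V + |G| = 1334`: the fat «sum law» `Σ R ≥ 2V + |G|` (true and tight in many small groups) fails here too.
WHAT THIS IS NOT: no STPP FAMILY with five such members is claimed (in this coordinate template at most three members can coexist —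
seat pencil, STATUS 2026-08-27); no census number; no `ω` statement; nothing about the orders `618–647` (this product structure needs `648 ∣ |G|`).
-/

-- single-conjunct summit: the mandated namespace repeats `MatrixMultiplication`.
set_option linter.dupNamespace false
set_option autoImplicit false

namespace Summit.MatrixMultiplication.MatrixMultiplication.Theorems

namespace STPPRoomRelaxation

open Finset Literature.Computability.AlgebraicComplexity
open scoped Pointwise

/-! ## Blocks on the three coordinate axes form a TPP triple -/

section axes

variable {X Y Z : Type*} [AddCommGroup X] [AddCommGroup Y] [AddCommGroup Z]

/-- **Coordinate blocks are TPP.**  In `X × Y × Z`, if `A` lies on the first axis, `B` on the second and `C` on the third, the one-member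
family `(A, B, C)` satisfies the census predicate `IsSTPP` (the TPP of the triple): `(s′−s) + (t′−t) + (u′−u) = 0` splits into its three
coordinates. [folklore] -/
theorem isSTPP_single_of_axes {A B C : Finset (X × Y × Z)}
    (hA : ∀ v ∈ A, v.2.1 = 0 ∧ v.2.2 = 0) (hB : ∀ v ∈ B, v.1 = 0 ∧ v.2.2 = 0) (hC : ∀ v ∈ C, v.1 = 0 ∧ v.2.1 = 0) :
    IsSTPP ![A] ![B] ![C] := by
  intro i j k s hs s' hs' t ht t' ht' u hu u' hu' h0
  fin_cases i; fin_cases j; fin_cases k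
  simp only [Fin.zero_eta, Fin.isValue, Matrix.cons_val_zero] at hs hs' ht ht' hu hu'
  have h1 := congrArg Prod.fst h0
  have h2 := congrArg (fun v => v.2.1) h0
  have h3 := congrArg (fun v => v.2.2) h0
  simp only [Prod.fst_add, Prod.fst_sub, Prod.snd_add, Prod.snd_sub, Prod.fst_zero, Prod.snd_zero] at h1 h2 h3
  obtain ⟨hs2, hs3⟩ := hA s hs; obtain ⟨hs'2, hs'3⟩ := hA s' hs'
  obtain ⟨ht1, ht3⟩ := hB t ht; obtain ⟨ht'1, ht'3⟩ := hB t' ht'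
  obtain ⟨hu1, hu2⟩ := hC u hu; obtain ⟨hu'1, hu'2⟩ := hC u' hu'
  rw [ht1, ht'1, hu1, hu'1] at h1
  rw [hs2, hs'2, hu2, hu'2] at h2
  rw [hs3, hs'3, ht3, ht'3] at h3
  simp only [sub_zero, add_zero, zero_add, sub_eq_zero] at h1 h2 h3
  refine ⟨rfl, rfl, Prod.ext h1.symm (Prod.ext ?_ ?_), Prod.ext ?_ (Prod.ext h2.symm ?_), Prod.ext ?_ (Prod.ext ?_ h3.symm)⟩
  · rw [hs2, hs'2]
  · rw [hs3, hs'3]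
  · rw [ht1, ht'1]
  · rw [ht3, ht'3]
  · rw [hu1, hu'1]
  · rw [hu2, hu'2]

end axes

/-! ## The witness at order 648 -/

/-- The host `ℤ/8 × ℤ/9 × ℤ/9` (an abelian group of order `648`). -/
abbrev G648 : Type := ZMod 8 × ZMod 9 × ZMod 9

/-- `A = {0,…,6} × 0 × 0` (the subgroup `ℤ/8 × 0 × 0` minus one point). -/
def blockA : Finset G648 := (Finset.univ.erase (7 : ZMod 8)).image fun x => (x, 0, 0)
/-- `B = 0 × {0,…,6} × 0` (the subgroup `0 × ℤ/9 × 0` minus two points). -/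
def blockB : Finset G648 := (((Finset.univ.erase (7 : ZMod 9)).erase 8)).image fun y => (0, y, 0)
/-- `C = 0 × 0 × {0,…,6}`. -/
def blockC : Finset G648 := (((Finset.univ.erase (7 : ZMod 9)).erase 8)).image fun z => (0, 0, z)

/-- The order of the host. [bookkeeping] -/
theorem card_G648 : Fintype.card G648 = 648 := by
  simp [G648, Fintype.card_prod, ZMod.card]

/-- The three blocks have `7` elements each. [bookkeeping] -/
theorem card_blocks : blockA.card = 7 ∧ blockB.card = 7 ∧ blockC.card = 7 := by decide

/-- The blocks lie on the three coordinate axes. [bookkeeping] -/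
theorem blocks_on_axes :
    (∀ v ∈ blockA, v.2.1 = 0 ∧ v.2.2 = 0) ∧ (∀ v ∈ blockB, v.1 = 0 ∧ v.2.2 = 0) ∧ (∀ v ∈ blockC, v.1 = 0 ∧ v.2.1 = 0) := by
  refine ⟨?_, ?_, ?_⟩
  · intro v hv; simp only [blockA, mem_image] at hv; obtain ⟨x, -, rfl⟩ := hv; exact ⟨rfl, rfl⟩
  · intro v hv; simp only [blockB, mem_image] at hv; obtain ⟨y, -, rfl⟩ := hv; exact ⟨rfl, rfl⟩
  · intro v hv; simp only [blockC, mem_image] at hv; obtain ⟨z, -, rfl⟩ := hv; exact ⟨rfl, rfl⟩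

/-- The witness is a TPP triple (census predicate on the one-member family). [original] -/
theorem isSTPP_witness648 : IsSTPP ![blockA] ![blockB] ![blockC] :=
  isSTPP_single_of_axes blocks_on_axes.1 blocks_on_axes.2.1 blocks_on_axes.2.2

set_option maxHeartbeats 0 in
/-- `R_A = |(A−A)+(B−C)| = 392 = 8·49` (kernel evaluation of the sumset). [original] -/
theorem roomA_777_648 : ((blockA - blockA) + (blockB - blockC)).card = 392 := by
  decide +kernel

set_option maxHeartbeats 0 in
/-- `R_B = |(B−B)+(C−A)| = 441 = 9·49` (kernel evaluation). [original] -/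
theorem roomB_777_648 : ((blockB - blockB) + (blockC - blockA)).card = 441 := by
  decide +kernel

set_option maxHeartbeats 0 in
/-- `R_C = |(C−C)+(A−B)| = 441 = 9·49` (kernel evaluation). [original] -/
theorem roomC_777_648 : ((blockC - blockC) + (blockA - blockB)).card = 441 := by
  decide +kernel

/-- **The three U14⁺ rooms of the witness are `392, 441, 441`.** [original] -/
theorem rooms_777_648 :
    ((blockA - blockA) + (blockB - blockC)).card = 392 ∧ ((blockB - blockB) + (blockC - blockA)).card = 441 ∧
      ((blockC - blockC) + (blockA - blockB)).card = 441 :=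
  ⟨roomA_777_648, roomB_777_648, roomC_777_648⟩

/-- **Single-member room constraints do not exclude `(7,7,7)⁵` at order 648.**  There is an abelian group of order `648` and a TPP triple of
`7`-sets in it whose three U14⁺ rooms are all at most `648 − 4·49 = 452`, the caps that the other four members of a `(7,7,7)⁵` family
would impose (and `2·343 > 648`, so every energy-type rule is active, not silent). [original] -/
theorem single_member_rooms_feasible_648 :
    ∃ (H : Type) (_ : AddCommGroup H) (_ : Fintype H) (_ : DecidableEq H) (A B C : Finset H),
      Fintype.card H = 648 ∧ A.card = 7 ∧ B.card = 7 ∧ C.card = 7 ∧ IsSTPP ![A] ![B] ![C] ∧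
      ((A - A) + (B - C)).card ≤ 648 - 4 * 49 ∧ ((B - B) + (C - A)).card ≤ 648 - 4 * 49 ∧
      ((C - C) + (A - B)).card ≤ 648 - 4 * 49 := by
  refine ⟨G648, inferInstance, inferInstance, inferInstance, blockA, blockB, blockC, card_G648, card_blocks.1, card_blocks.2.1,
    card_blocks.2.2, isSTPP_witness648, ?_, ?_, ?_⟩
  · rw [roomA_777_648]; norm_num
  · rw [roomB_777_648]; norm_num
  · rw [roomC_777_648]; norm_num

end STPPRoomRelaxation

end Summit.MatrixMultiplication.MatrixMultiplication.Theorems
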